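import Summits.NavierStokesRegularity.NavierStokesRegularity.Theorems.IsotropicBlobProfiles
import Summits.NavierStokesRegularity.NavierStokesRegularity.Theorems.HarmonicShellLineGlue
import HarnessLib

/-!
# IsotropicBlobPressureProfiles — the glued `C²` zonal pressure profiles `Φ₀, Φ₂, Φ₄` of the witness (W2)

Plate (Φ) of the LEAD S-door's plate map v3 (ns-s30-p1 g4, 2026-08-28T22:38:39Z), part 2/2 over the data layer
`Theorems/IsotropicBlobProfiles` (ns-s29-p2 g5) and the glue plate L `Theorems/HarmonicShellLineGlue` (LEAD):
the three zonal profiles of the witness pressure `p(x) = Φ₀(|x|²) + Φ₂(|x|²)Z₂(x) + Φ₄(|x|²)Z₄(x)`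
(nsreg-p1 g33 «Glue1D», `r41/glue1d_k4.txt` 820188708bb31402) as GLUED functions on `ℝ`,

  `Phi0 := lineGlue 1 phi0In (fun _ => 0)`, `Phi2 := lineGlue 1 phi2In phi2Out`, `Phi4 := lineGlue 1 phi4In phi4Out`,

with, BY NAME: `contDiff_Phiₗ : ContDiff ℝ 2 Phiₗ` (`HarmonicShell.contDiff_two_lineGlue` + the matchings of the data
layer), the branch formulas for `Phiₗ`, `deriv Phiₗ`, `deriv (deriv Phiₗ)`, the **1-D Poisson identities at every `s`**
`4s·Φₗ″(s) + (4l+6)·Φₗ′(s) = (if s ≤ 1 then Fₗ s else 0)` (what R1 `HarmonicShell.laplacian_radial_mul` turns into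
`Δp = f` inside and `Δp = 0` outside, pointwise), the exterior values / decay data (`Phiₗ s = cₗ·s^{−(2l+1)/2}`,
`|Phi₂ s| ≤ c₂ s^{−5/2}`, `|Phi₄ s| ≤ c₄ s^{−9/2}`, `Phi₀ s = 0` for `1 ≤ s`) and the centre data
(`Phiₗ 0`, `deriv Phiₗ 0`, `2·Φ₀′(0) + 4·Φ₂(0) = −9/14`). Everything proved; no named facts;
`--supports stmt-NavierStokesRegularity-0056 --as helper` (typed by ns-s29-p2 g5).

HONEST FRAME: explicit data of ONE kinematic witness calibrating the S40/S41 clock doors; items 0056 `NoTypeII`,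
10661 and NS regularity are NOT proved; nothing here is a route or a summit statement.
-/

noncomputable section

open Set Filter
open scoped Topology

set_option linter.dupNamespace false

namespace Summit.NavierStokesRegularity.NavierStokesRegularity.Theorems.StrainDoors.IsotropicBlob

open Summit.NavierStokesRegularity.NavierStokesRegularity.Theorems.StrainDoors.HarmonicShell

/-! ## §1 The glued profiles -/

/-- support (definition): `Φ₀ = Φ₀ⁱⁿ` on `s ≤ 1`, `0` beyond (no monopole). -/
def Phi0 : ℝ → ℝ := lineGlue 1 phi0In (fun _ => 0)

/-- support (definition): `Φ₂ = Φ₂ⁱⁿ` on `s ≤ 1`, the quadrupole `c₂ s^{−5/2}` beyond. -/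
def Phi2 : ℝ → ℝ := lineGlue 1 phi2In phi2Out

/-- support (definition): `Φ₄ = Φ₄ⁱⁿ` on `s ≤ 1`, the hexadecapole `c₄ s^{−9/2}` beyond. -/
def Phi4 : ℝ → ℝ := lineGlue 1 phi4In phi4Out

/-! ## §2 The gluing hypotheses (from the data layer) -/

/-- `Φ₀ⁱⁿ` is `C²` at every point (a polynomial). -/
theorem phi0In_hf : ∀ s : ℝ, s ≤ 1 → ContDiffAt ℝ 2 phi0In s := fun _ _ => contDiff_phi0In.contDiffAt
/-- the zero exterior profile is `C²`. -/
theorem phi0Out_hg : ∀ s : ℝ, 1 ≤ s → ContDiffAt ℝ 2 (fun _ : ℝ => (0 : ℝ)) s := fun _ _ => contDiffAt_const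
/-- h0 for `l = 0`. -/
theorem phi0_h0 : phi0In 1 = (fun _ : ℝ => (0 : ℝ)) 1 := phi0In_one
/-- h1 for `l = 0`. -/
theorem phi0_h1 : deriv phi0In 1 = deriv (fun _ : ℝ => (0 : ℝ)) 1 := by
  rw [deriv_phi0In_one, deriv_const]
/-- h2 for `l = 0`. -/
theorem phi0_h2 : deriv (deriv phi0In) 1 = deriv (deriv (fun _ : ℝ => (0 : ℝ))) 1 := by
  rw [deriv_deriv_phi0In_one, deriv_const', deriv_const]

/-- `Φ₂ⁱⁿ` is `C²` at every point. -/
theorem phi2In_hf : ∀ s : ℝ, s ≤ 1 → ContDiffAt ℝ 2 phi2In s := fun _ _ => contDiff_phi2In.contDiffAt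
/-- `Φ₂ᵒᵘᵗ` is `C²` on `1 ≤ s`. -/
theorem phi2Out_hg : ∀ s : ℝ, 1 ≤ s → ContDiffAt ℝ 2 phi2Out s :=
  fun _ hs => contDiffAt_phi2Out (lt_of_lt_of_le one_pos hs)
/-- `Φ₄ⁱⁿ` is `C²` at every point. -/
theorem phi4In_hf : ∀ s : ℝ, s ≤ 1 → ContDiffAt ℝ 2 phi4In s := fun _ _ => contDiff_phi4In.contDiffAt
/-- `Φ₄ᵒᵘᵗ` is `C²` on `1 ≤ s`. -/
theorem phi4Out_hg : ∀ s : ℝ, 1 ≤ s → ContDiffAt ℝ 2 phi4Out s :=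
  fun _ hs => contDiffAt_phi4Out (lt_of_lt_of_le one_pos hs)

/-! ## §3 `C²` regularity and branch formulas -/

/-- **`Φ₀ ∈ C²(ℝ)`**. -/
theorem contDiff_Phi0 : ContDiff ℝ 2 Phi0 := contDiff_two_lineGlue phi0In_hf phi0Out_hg phi0_h0 phi0_h1 phi0_h2

/-- **`Φ₂ ∈ C²(ℝ)`**. -/
theorem contDiff_Phi2 : ContDiff ℝ 2 Phi2 :=
  contDiff_two_lineGlue phi2In_hf phi2Out_hg phi2In_one deriv_phi2In_one deriv_deriv_phi2In_one

/-- **`Φ₄ ∈ C²(ℝ)`**. -/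
theorem contDiff_Phi4 : ContDiff ℝ 2 Phi4 :=
  contDiff_two_lineGlue phi4In_hf phi4Out_hg phi4In_one deriv_phi4In_one deriv_deriv_phi4In_one

/-- `Φ₀ = Φ₀ⁱⁿ` on `s ≤ 1`. -/
theorem Phi0_of_le {s : ℝ} (h : s ≤ 1) : Phi0 s = phi0In s := lineGlue_of_le h
/-- `Φ₀ = 0` on `1 ≤ s`. -/
theorem Phi0_of_ge {s : ℝ} (h : 1 ≤ s) : Phi0 s = 0 := lineGlue_of_ge phi0_h0 h
/-- `Φ₂ = Φ₂ⁱⁿ` on `s ≤ 1`. -/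
theorem Phi2_of_le {s : ℝ} (h : s ≤ 1) : Phi2 s = phi2In s := lineGlue_of_le h
/-- `Φ₂ = Φ₂ᵒᵘᵗ` on `1 ≤ s`. -/
theorem Phi2_of_ge {s : ℝ} (h : 1 ≤ s) : Phi2 s = phi2Out s := lineGlue_of_ge phi2In_one h
/-- `Φ₄ = Φ₄ⁱⁿ` on `s ≤ 1`. -/
theorem Phi4_of_le {s : ℝ} (h : s ≤ 1) : Phi4 s = phi4In s := lineGlue_of_le h
/-- `Φ₄ = Φ₄ᵒᵘᵗ` on `1 ≤ s`. -/
theorem Phi4_of_ge {s : ℝ} (h : 1 ≤ s) : Phi4 s = phi4Out s := lineGlue_of_ge phi4In_one h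

/-- `Φ₀′` branchwise. -/
theorem deriv_Phi0 (s : ℝ) : deriv Phi0 s = if s ≤ 1 then deriv phi0In s else 0 := by
  rw [Phi0, deriv_lineGlue phi0In_hf phi0Out_hg phi0_h0 phi0_h1 phi0_h2 s, deriv_const]
/-- `Φ₀″` branchwise. -/
theorem deriv_deriv_Phi0 (s : ℝ) : deriv (deriv Phi0) s = if s ≤ 1 then deriv (deriv phi0In) s else 0 := by
  rw [Phi0, deriv_deriv_lineGlue phi0In_hf phi0Out_hg phi0_h0 phi0_h1 phi0_h2 s, deriv_const', deriv_const]
/-- `Φ₂′` branchwise. -/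
theorem deriv_Phi2 (s : ℝ) : deriv Phi2 s = if s ≤ 1 then deriv phi2In s else deriv phi2Out s := by
  rw [Phi2, deriv_lineGlue phi2In_hf phi2Out_hg phi2In_one deriv_phi2In_one deriv_deriv_phi2In_one s]
/-- `Φ₂″` branchwise. -/
theorem deriv_deriv_Phi2 (s : ℝ) :
    deriv (deriv Phi2) s = if s ≤ 1 then deriv (deriv phi2In) s else deriv (deriv phi2Out) s := by
  rw [Phi2, deriv_deriv_lineGlue phi2In_hf phi2Out_hg phi2In_one deriv_phi2In_one deriv_deriv_phi2In_one s]
/-- `Φ₄′` branchwise. -/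
theorem deriv_Phi4 (s : ℝ) : deriv Phi4 s = if s ≤ 1 then deriv phi4In s else deriv phi4Out s := by
  rw [Phi4, deriv_lineGlue phi4In_hf phi4Out_hg phi4In_one deriv_phi4In_one deriv_deriv_phi4In_one s]
/-- `Φ₄″` branchwise. -/
theorem deriv_deriv_Phi4 (s : ℝ) :
    deriv (deriv Phi4) s = if s ≤ 1 then deriv (deriv phi4In) s else deriv (deriv phi4Out) s := by
  rw [Phi4, deriv_deriv_lineGlue phi4In_hf phi4Out_hg phi4In_one deriv_phi4In_one deriv_deriv_phi4In_one s]

/-! ## §4 The 1-D Poisson identities at every `s` -/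

/-- **`4s·Φ₀″ + 6·Φ₀′ = F₀·𝟙_{s ≤ 1}`** at every `s`. -/
theorem poisson_Phi0 (s : ℝ) :
    4 * s * deriv (deriv Phi0) s + 6 * deriv Phi0 s = if s ≤ 1 then F0 s else 0 := by
  rw [deriv_deriv_Phi0, deriv_Phi0]
  split_ifs with h
  · exact poisson_phi0In s
  · ring

/-- **`4s·Φ₂″ + 14·Φ₂′ = F₂·𝟙_{s ≤ 1}`** at every `s`. -/
theorem poisson_Phi2 (s : ℝ) :
    4 * s * deriv (deriv Phi2) s + 14 * deriv Phi2 s = if s ≤ 1 then F2 s else 0 := by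
  rw [deriv_deriv_Phi2, deriv_Phi2]
  split_ifs with h
  · exact poisson_phi2In s
  · exact poisson_phi2Out (lt_trans one_pos (not_le.1 h))

/-- **`4s·Φ₄″ + 22·Φ₄′ = F₄·𝟙_{s ≤ 1}`** at every `s`. -/
theorem poisson_Phi4 (s : ℝ) :
    4 * s * deriv (deriv Phi4) s + 22 * deriv Phi4 s = if s ≤ 1 then F4 s else 0 := by
  rw [deriv_deriv_Phi4, deriv_Phi4]
  split_ifs with h
  · exact poisson_phi4In s
  · exact poisson_phi4Out (lt_trans one_pos (not_le.1 h))

/-! ## §5 Exterior values, decay data and centre data -/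

/-- exterior: `Φ₂(s) = c₂·s^{−5/2}` for `1 ≤ s`. -/
theorem Phi2_eq_of_ge {s : ℝ} (h : 1 ≤ s) : Phi2 s = (16384/61108047 : ℝ) * s ^ (-(5 : ℝ) / 2) :=
  Phi2_of_ge h

/-- exterior: `Φ₄(s) = c₄·s^{−9/2}` for `1 ≤ s`. -/
theorem Phi4_eq_of_ge {s : ℝ} (h : 1 ≤ s) : Phi4 s = (8192/111546435 : ℝ) * s ^ (-(9 : ℝ) / 2) :=
  Phi4_of_ge h

/-- decay: `|Φ₂(s)| ≤ c₂·s^{−5/2}` for `1 ≤ s`. -/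
theorem abs_Phi2_le {s : ℝ} (h : 1 ≤ s) : |Phi2 s| ≤ (16384/61108047 : ℝ) * s ^ (-(5 : ℝ) / 2) := by
  rw [Phi2_eq_of_ge h, abs_of_nonneg (by positivity)]

/-- decay: `|Φ₄(s)| ≤ c₄·s^{−9/2}` for `1 ≤ s`. -/
theorem abs_Phi4_le {s : ℝ} (h : 1 ≤ s) : |Phi4 s| ≤ (8192/111546435 : ℝ) * s ^ (-(9 : ℝ) / 2) := by
  rw [Phi4_eq_of_ge h, abs_of_nonneg (by positivity)]

/-- crude decay: `|Φ₂(s)| ≤ c₂·s⁻¹` and `|Φ₄(s)| ≤ c₄·s⁻¹` for `1 ≤ s` (enough with `|Z₂| ≤ 2|x|²`… no: use the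
sharp forms above with `|Z₂ x| ≤ 2‖x‖²`, `|Z₄ x| ≤ 35‖x‖⁴`; this lemma records `s^{−a} ≤ s⁻¹` for `a ≥ 1`). -/
theorem rpow_neg_le_inv {s a : ℝ} (hs : 1 ≤ s) (ha : 1 ≤ a) : s ^ (-a) ≤ s⁻¹ := by
  rw [← Real.rpow_neg_one]
  exact Real.rpow_le_rpow_of_exponent_le hs (by linarith)

/-- centre values `Φ₀(0) = 47/3780`, `Φ₂(0) = −1/28`, `Φ₄(0) = 52/735`. -/
theorem Phi_zero : Phi0 0 = 47 / 3780 ∧ Phi2 0 = -1 / 28 ∧ Phi4 0 = 52 / 735 := by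
  rw [Phi0_of_le zero_le_one, Phi2_of_le zero_le_one, Phi4_of_le zero_le_one]
  exact ⟨profiles_zero.1, profiles_zero.2.1, profiles_zero.2.2.1⟩

/-- centre slopes `Φ₀′(0) = −1/4`, `Φ₂′(0) = 2/7`, `Φ₄′(0) = −172/385`. -/
theorem deriv_Phi_zero : deriv Phi0 0 = -1 / 4 ∧ deriv Phi2 0 = 2 / 7 ∧ deriv Phi4 0 = -172 / 385 := by
  rw [deriv_Phi0, deriv_Phi2, deriv_Phi4, if_pos zero_le_one, if_pos zero_le_one, if_pos zero_le_one]
  exact deriv_profiles_zero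

/-- **the centre datum**: `2·Φ₀′(0) + 4·Φ₂(0) = −9/14` (`= ∂_zz p(0)` of the witness; feed ratio `9/14`). -/
theorem centre_zz_Phi : 2 * deriv Phi0 0 + 4 * Phi2 0 = -(9 / 14) := by
  rw [deriv_Phi_zero.1, Phi_zero.2.1]; norm_num

end Summit.NavierStokesRegularity.NavierStokesRegularity.Theorems.StrainDoors.IsotropicBlob

end
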